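import Summits.BirchSwinnertonDyer.BirchSwinnertonDyer.Theorems.PrintCFramBottomClassIndexLawFiveLeSelmerCountLevelZero
import Summits.BirchSwinnertonDyer.BirchSwinnertonDyer.Theorems.PrintCFramBottomClassIndexLawFiveLeSelmerCountCharacterSupply
import Summits.BirchSwinnertonDyer.BirchSwinnertonDyer.Theorems.PrintCFramBottomClassIndexLawFiveLeKummerEigenclassOfComponent
import HarnessLib

/-!
# Route `PrintCFram`, crux C2 `BottomClassIndexLawFiveLe` (stmt-BirchSwinnertonDyer-20372), line
# `eisenstein-resource-bdp-line` (registry v22, stubs B1-level `stub_bsdp_of_level` / B1-sha `stub_bsdp_of_sha`):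
# **EVEN-IRREGULAR ∧ LEVEL 0 ⟹ `Ш(W/ℚ)[p] ≠ 0`** — the local count `#R_rel(Φ) ≤ p · #R_str(Φ)` (Tate's local Euler characteristic, the
# tree's named fact `localEulerPoincareCharacteristic ℚ_v`) joined to the level-0 injection `R_str(Φ) ↪ Ш(W)[p]`
# (cell `bsd-print-cfram`, width seat `bsd-line-cfram-p1-w2` g11; helper `--supports` 20372; 0 defs, 0 facts, 0 sorry;
# CONDITIONAL on `localEulerPoincareCharacteristic ℚ_v` exactly as `…SelmerCountCoalignedOfLocal`)

HONEST FRAMING. Nothing about BSD is proved here and no stub is closed. With `…SelmerCountLevelZero` (this seat: at LEVEL `0` the strict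
residual classes inject into `Ш(W)[p]`) the only missing step to «EVEN-IRREGULAR ∧ LEVEL 0 ⟹ B1-sha's premise» is the index bound
`[R_rel(Φ) : R_str(Φ)] ≤ #H¹(ℚ_v, Φ) = p`: the restriction `H¹(Γ_ℚ, Φ) → H¹(Γ_v, Φ|_{Γ_v})` has kernel `ker res_{D_v}` (`D_v = res Γ_v`),
and its target has `p` elements by w2 g10's `natCard_galoisCohomology_one_eq_prime_of_localEuler` (the local module `Φ|_{Γ_v}` is built
exactly as in `coaligned_of_forall_exists_adaptedRoot`). Consequences, all on the CM-ramified rank-one class: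

* §1 **`natCard_h1Unramified_le_prime_mul_natCard_strict`** — `#h1Unramified Φ.Sub S ≤ p · #(h1Unramified Φ.Sub S ⊓ ker res_{D_v})`
  (any `S`; inputs `#Φ = p`, `Φ^{D_v} = 0`, a non-cyclotomic homothety in `D_v`, `localEulerPoincareCharacteristic ℚ_v`);
* §2 **`exists_sha_ne_zero_of_level_zero_of_sq_le_of_cmRamified`** — class member, LEVEL `0`, `p² ≤ #R_rel(Φ)` ⟹ `Ш(W)[p] ≠ 0` — the
  LEVEL-0 twin of w2 g10's `exists_sha_ne_zero_of_forall_exists_adaptedRoot_of_sq_le_of_cmRamified` (same conclusion, (LA) replaced by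
  level `0`);
* §3 **`exists_sha_ne_zero_of_level_zero_of_classGroupChiCard_ne_one_of_cmRamified`** — class member of rank one, LEVEL `0`, odd line `Φ`
  with character `θ`, reflection field `K` (CM, Galois, `ζ_p`, `p ∤ [K:ℚ]`, `θ(res Γ_K) = 1`), descent `χ̄` of `θ`, `ψ̄ = ā χ̄⁻¹ ≠ 1`,
  EVEN-IRREGULARITY `#e_{ω∘ψ̄}(ℤ_p ⊗ Cl K) ≠ 1` ⟹ `∃ c ∈ Ш(W/ℚ), c ≠ 0 ∧ p • c = 0` (w7 g4's two Kummer characters p684941 ⟹ this seat's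
  `sq_le_natCard_h1Unramified_of_two_characters` p684559 ⟹ §2).

NET FOR THE DOSSIER (B1): an EVEN-IRREGULAR rank-one member either has LEVEL `≥ 1` (premise of `stub_bsdp_of_level`) or `Ш(W)[p] ≠ 0`
(premise of `stub_bsdp_of_sha`) — with NO case ((LA)/(LT)) hypothesis; together with w4 g10's «EVEN-REGULAR ⟹ `Ш(W)[p] = 0`» (p683684,
mod CT+GZK) the pair (B1-level, B1-sha) covers exactly «level ≥ 1 ∨ even-irregular». THEOREMS ONLY; no definition, no named fact, no
`sorry`. BSD is not proved by any of this; no summit statement is proved by this seat. References: [MilneADT2006] I Thm. 2.8, Cor. 2.3;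
[SerreGaloisCohomology1997] I.§2.6 (b), II.§5; [SilvermanAEC2009] X.§4; [Washington1997] §10.2; seat notes w2g10 §2, w2g11, w7g4.
-/

set_option autoImplicit false
-- `…BirchSwinnertonDyer.BirchSwinnertonDyer.Theorems…` is the problem's mandated namespace (D-0017).
set_option linter.dupNamespace false

noncomputable section

open scoped Classical

namespace Summit.BirchSwinnertonDyer.BirchSwinnertonDyer.Theorems.PrintCFram.SelmerCount

open NumberField IsDedekindDomain Field WeierstrassCurve
open Literature.NumberTheory.EllipticCurves Literature.NumberTheory.GaloisRepresentations
  Literature.NumberTheory.EllipticCurves.GreenbergSelmer Literature.NumberTheory.EllipticCurves.Rank1Residual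
  Literature.NumberTheory.NumberFields
open Literature.NumberTheory.GaloisRepresentations.DiscreteGaloisModule (mu MuCarrier)
open Summit.BirchSwinnertonDyer.Rank1Residual.X2.ResidualDevissageModules
open scoped ContRepresentation

/-! ## §1 The local count: `[R_rel(Φ) : R_str(Φ)] ≤ #H¹(ℚ_v, Φ) = p` -/

section LocalCount

variable (W : WeierstrassCurve ℚ) [W.IsElliptic]
variable {p : ℕ} [hp : Fact p.Prime] (v : HeightOneSpectrum (𝓞 ℚ))
  (Φ : StableSubgroup (absoluteGaloisGroup ℚ) (geomTorsion W (p : ℤ)))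

omit [W.IsElliptic] in
/-- **`#h1Unramified Φ.Sub S ≤ p · #(h1Unramified Φ.Sub S ⊓ ker res_{D_v})`, granted the local Euler characteristic.** `W/ℚ` elliptic,
`v ∋ p`, `Φ ≤ W[p]` stable of order `p` with `Φ^{D_v} = 0` and some `g ∈ D_v` acting as a scalar `c` with `χ̄_p(g) ≢ c` (so
`Hom_{Γ_v}(Φ, μ_p) = 0`); ASSUME `localEulerPoincareCharacteristic ℚ_v`. The restriction `H¹(Γ_ℚ, Φ) → H¹(Γ_v, Φ|_{Γ_v})`, `[w] ↦ [w ∘ res]`,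
has kernel `ker res_{D_v}` (`D_v = res(Γ_v)`) and a target with `p` elements (w2 g10's `natCard_galoisCohomology_one_eq_prime_of_localEuler`),
so every subgroup `H ≤ H¹(Γ_ℚ, Φ)` satisfies `#H ≤ p · #(H ⊓ ker res_{D_v})`. [cite: MilneADT2006, Ch. I §2 Thm. 2.8 and Cor. 2.3]
[cite: SerreGaloisCohomology1997, II §5.7] -/
theorem natCard_h1Unramified_le_prime_mul_natCard_strict (hpv : ((p : ℕ) : 𝓞 ℚ) ∈ v.asIdeal)
    (hEP : localEulerPoincareCharacteristic (v.adicCompletion ℚ))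
    (hcard : Nat.card Φ.Sub = p)
    (hSD : ∀ s : Φ.Sub, (∀ g ∈ decomp v, g • s = s) → s = 0)
    (hSμ : ∃ g ∈ decomp v, ∃ c : ℤ, (∀ s : Φ.Sub, g • s = c • s) ∧
      ((modNCyclotomicCharacter ℚ p g : (ZMod p)ˣ) : ZMod p) ≠ (c : ZMod p))
    (S : Set (HeightOneSpectrum (𝓞 ℚ))) :
    Nat.card ↥(h1Unramified Φ.Sub S) ≤ p * Nat.card ↥(h1Unramified Φ.Sub S ⊓ subgroupResKer Φ.Sub (decomp v)) := by
  have hpr : p.Prime := hp.out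
  haveI : NeZero p := ⟨hpr.ne_zero⟩
  haveI : Finite Φ.Sub := Nat.finite_of_card_ne_zero (by rw [hcard]; exact hpr.ne_zero)
  let Γ := absoluteGaloisGroup ℚ
  let Γv := absoluteGaloisGroup (v.adicCompletion ℚ)
  have hcontM : ∀ m : geomTorsion W (p : ℤ), Continuous fun g : absoluteGaloisGroup ℚ ↦ g • m :=
    LevelDictionary.continuous_smul_geomTorsion W (p : ℤ)
  have hcontS : ∀ s : Φ.Sub, Continuous fun g : absoluteGaloisGroup ℚ ↦ g • s := Φ.continuous_smul_sub hcontM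
  -- the local module `Φ|_{Γ_v}` (as in `coaligned_of_forall_exists_adaptedRoot`)
  let repS : Representation ℤ Γv Φ.Sub :=
    { toFun := fun σ ↦ (DistribSMul.toAddMonoidHom Φ.Sub (absGaloisRestrict ℚ (v.adicCompletion ℚ) σ)).toIntLinearMap
      map_one' := by
        ext s
        change absGaloisRestrict ℚ (v.adicCompletion ℚ) 1 • s = s
        rw [map_one, one_smul]
      map_mul' := fun σ τ ↦ by
        ext s
        change absGaloisRestrict ℚ (v.adicCompletion ℚ) (σ * τ) • s =
          absGaloisRestrict ℚ (v.adicCompletion ℚ) σ • (absGaloisRestrict ℚ (v.adicCompletion ℚ) τ • s)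
        rw [map_mul, mul_smul] }
  let ρS : DiscreteGaloisModule (v.adicCompletion ℚ) Φ.Sub :=
    DiscreteGaloisModule.ofIsOpenStabilizer repS fun s ↦ by
      have h : IsOpen ((fun g : absoluteGaloisGroup ℚ ↦ g • s) ⁻¹' {s}) :=
        (isOpen_discrete ({s} : Set Φ.Sub)).preimage (hcontS s)
      exact h.preimage (absGaloisRestrict ℚ (v.adicCompletion ℚ)).continuous
  have hρS : ∀ (σ : Γv) (s : Φ.Sub), ρS σ s = absGaloisRestrict ℚ (v.adicCompletion ℚ) σ • s := fun _ _ ↦ rfl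
  -- `#H¹(Γ_v, Φ) = p`
  have hinv : ∀ s : Φ.Sub, (∀ σ : Γv, ρS σ s = s) → s = 0 := fun s hs ↦
    hSD s fun g hg ↦ by
      obtain ⟨σ, rfl⟩ := (mem_decomp_iff v g).1 hg
      exact hs σ
  have hdual : ∀ f : HomCarrier Φ.Sub (MuCarrier (v.adicCompletion ℚ) p),
      (∀ (σ : Γv) (a : Φ.Sub), mu (v.adicCompletion ℚ) p σ (f a) = f (ρS σ a)) → f = 0 := by
    intro f hf
    obtain ⟨g, hg, c, hgc, hne⟩ := hSμ
    obtain ⟨σ₀, rfl⟩ := (mem_decomp_iff v g).1 hg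
    refine HomCarrier.ext fun a ↦ ?_
    have h := hf σ₀ a
    rw [mu_adicCompletion_apply, hρS, hgc, map_zsmul, ← natCast_zsmul] at h
    have h' : ((((modNCyclotomicCharacter ℚ p (absGaloisRestrict ℚ (v.adicCompletion ℚ) σ₀) : (ZMod p)ˣ) :
        ZMod p).val : ℤ) - c) • f a = 0 := by
      rw [sub_zsmul, h]; simp
    refine muCarrier_eq_zero_of_zsmul_eq_zero v (m := _) (fun hdvd ↦ hne ?_) (f a) h'
    rw [← sub_eq_zero, ← ZMod.natCast_zmod_val ((modNCyclotomicCharacter ℚ p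
        (absGaloisRestrict ℚ (v.adicCompletion ℚ) σ₀) : (ZMod p)ˣ) : ZMod p),
      ← Int.cast_natCast, ← Int.cast_sub, ZMod.intCast_zmod_eq_zero_iff_dvd]
    exact hdvd
  obtain ⟨hfinS, hcardS⟩ := natCard_galoisCohomology_one_eq_prime_of_localEuler v hpv hEP ρS hcard hinv hdual
  haveI := hfinS
  -- the restriction `r : H¹(Γ_ℚ, Φ) → H¹(Γ_v, Φ|)`, `[w] ↦ [w ∘ res]`
  let r : discreteH1 Γ Φ.Sub →+ galoisCohomology ρS 1 :=
    (ContinuousCohomology.map (absGaloisRestrict ℚ (v.adicCompletion ℚ)) (X := discreteTopRep Γ Φ.Sub) (Y := ρS.toTopRep)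
      (TopRep.ofHom ⟨ContinuousLinearMap.id ℤ Φ.Sub, fun _ ↦ rfl⟩) 1).hom.toLinearMap.toAddMonoidHom
  have hr : ∀ w, r (oneCocycleClass _ w) = oneCocycleClass ρS.toTopRep
      (contOneCocycles.pullback (absGaloisRestrict ℚ (v.adicCompletion ℚ)) (X := discreteTopRep Γ Φ.Sub) (Y := ρS.toTopRep)
        (TopRep.ofHom ⟨ContinuousLinearMap.id ℤ Φ.Sub, fun _ ↦ rfl⟩) w) := fun w ↦ map_oneCocycleClass _ _ _ w
  -- its kernel is `ker res_{D_v}`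
  have hker : ∀ c : discreteH1 Γ Φ.Sub, r c = 0 ↔ c ∈ subgroupResKer Φ.Sub (decomp v) := by
    intro c
    obtain ⟨w, rfl⟩ := oneCocycleClass_surjective _ c
    rw [hr, oneCocycleClass_mem_subgroupResKer_iff]
    refine (oneCocycleClass_eq_zero_iff _ _).trans ⟨?_, ?_⟩
    · rintro ⟨s, hs⟩
      refine ⟨s, fun τ ↦ ?_⟩
      obtain ⟨σ, hσ⟩ := (mem_decomp_iff v (τ : Γ)).1 τ.2
      have h := hs σ
      change w.1 (absGaloisRestrict ℚ (v.adicCompletion ℚ) σ) = absGaloisRestrict ℚ (v.adicCompletion ℚ) σ • s - s at h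
      rw [hσ] at h
      exact h
    · rintro ⟨s, hs⟩
      refine ⟨s, fun σ ↦ ?_⟩
      change w.1 (absGaloisRestrict ℚ (v.adicCompletion ℚ) σ) = absGaloisRestrict ℚ (v.adicCompletion ℚ) σ • s - s
      exact hs ⟨_, ⟨σ, rfl⟩⟩
  -- count: restrict `r` to `H = h1Unramified Φ.Sub S`
  set H := h1Unramified Φ.Sub S with hH
  let f : H →+ galoisCohomology ρS 1 := r.comp H.subtype
  have h1 : Nat.card H = Nat.card (H ⧸ f.ker) * Nat.card f.ker := AddSubgroup.card_eq_card_quotient_mul_card_addSubgroup _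
  have h2 : Nat.card (H ⧸ f.ker) ≤ p :=
    calc Nat.card (H ⧸ f.ker) = Nat.card f.range := Nat.card_congr (QuotientAddGroup.quotientKerEquivRange f).toEquiv
      _ ≤ Nat.card (galoisCohomology ρS 1) := Nat.card_le_card_of_injective _ f.range.subtype_injective
      _ = p := hcardS
  have h3 : Nat.card f.ker = Nat.card ↥(H ⊓ subgroupResKer Φ.Sub (decomp v)) := by
    have hk : f.ker = (subgroupResKer Φ.Sub (decomp v)).addSubgroupOf H := by
      ext x
      rw [AddMonoidHom.mem_ker, AddSubgroup.mem_addSubgroupOf]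
      exact hker x.1
    rw [hk, ← AddSubgroup.inf_addSubgroupOf_left]
    exact Nat.card_congr (AddSubgroup.addSubgroupOfEquivOfLe (inf_le_left : H ⊓ subgroupResKer Φ.Sub (decomp v) ≤ H)).toEquiv
  calc Nat.card H = Nat.card (H ⧸ f.ker) * Nat.card f.ker := h1
    _ ≤ p * Nat.card ↥(H ⊓ subgroupResKer Φ.Sub (decomp v)) := by rw [h3]; exact Nat.mul_le_mul_right _ h2

end LocalCount

/-! ## §2 On the CM-ramified class: LEVEL 0 ∧ `#R_rel(Φ) ≥ p²` ⟹ `Ш(W/ℚ)[p] ≠ 0` -/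

section Class

variable (W : WeierstrassCurve ℚ) [W.IsElliptic] [W.IsGloballyMinimal]
variable {p : ℕ} [hp : Fact p.Prime]

/-- **LEVEL `0` ∧ `#R_rel(Φ) ≥ p²` ⟹ `Ш(W/ℚ)[p] ≠ 0` ON THE CM-RAMIFIED CLASS, granted the local Euler characteristic** — the LEVEL-0 twin of
w2 g10's `exists_sha_ne_zero_of_forall_exists_adaptedRoot_of_sq_le_of_cmRamified` (there: (LA) at `p`; here: the generator is NOT
`p`-divisible in `W(ℚ_p)`). `#R_rel ≤ p · #R_str` (§1, class inputs `Φ^{D_p} = 0` and the non-cyclotomic homothety from w2 g10) makes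
`#R_str ≥ p`, and `…SelmerCountLevelZero` §3 concludes. [cite: MilneADT2006, Ch. I §2 Thm. 2.8] [cite: SilvermanAEC2009, Thm. X.4.2 (a)] -/
theorem exists_sha_ne_zero_of_level_zero_of_sq_le_of_cmRamified
    (hCM : W.HasCM) (hram : CMRamified W p) (h5 : 5 ≤ p)
    {v : HeightOneSpectrum (𝓞 ℚ)} (hpv : ((p : ℕ) : 𝓞 ℚ) ∈ v.asIdeal)
    (hEP : localEulerPoincareCharacteristic (v.adicCompletion ℚ))
    (Φ : StableSubgroup (absoluteGaloisGroup ℚ) (geomTorsion W (p : ℤ))) (hcard : Nat.card Φ.Sub = p)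
    (P : W.toAffine.Point)
    (hgen : ∀ R : W.toAffine.Point, ∃ (k : ℤ) (T : W.toAffine.Point), IsOfFinAddOrder T ∧ R = k • P + T)
    (hlev : ∀ Q : (W.baseChange ℚ_[p]).toAffine.Point, p • Q ≠ W.toPadicPoint p P)
    (hsq : p ^ 2 ≤ Nat.card ↥(h1Unramified Φ.Sub {v' : HeightOneSpectrum (𝓞 ℚ) | ((p : ℕ) : 𝓞 ℚ) ∈ v'.asIdeal})) :
    ∃ c ∈ W.sha, c ≠ 0 ∧ p • c = 0 := by
  have hSD : ∀ s : Φ.Sub, (∀ g ∈ decomp v, g • s = s) → s = 0 := fun s hs ↦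
    LevelDictionaryAlpha.sub_eq_zero_of_forall_inertia_smul_eq_at_p W Φ hCM h5 hram hcard hpv
      (adicCompletionPrime_mem_primesAbove ℚ v) s fun g hg ↦ hs g (by
        have h := Ideal.inertia_le_decompositionSubgroup (absoluteGaloisGroup ℚ) (adicCompletionPrime ℚ v) hg
        rw [decompositionSubgroup_adicCompletionPrime_eq_range] at h
        exact h)
  have hSμ := exists_decomp_homothety_ne_cyclotomic_of_cmRamified W hCM h5 hram Φ hcard hpv
  have hcount := natCard_h1Unramified_le_prime_mul_natCard_strict W v Φ hpv hEP hcard hSD hSμ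
    {v' : HeightOneSpectrum (𝓞 ℚ) | ((p : ℕ) : 𝓞 ℚ) ∈ v'.asIdeal}
  have hle : p ≤ Nat.card ↥(h1Unramified Φ.Sub {v' : HeightOneSpectrum (𝓞 ℚ) | ((p : ℕ) : 𝓞 ℚ) ∈ v'.asIdeal} ⊓
      subgroupResKer Φ.Sub (decomp v)) :=
    Nat.le_of_mul_le_mul_left ((pow_two p ▸ hsq).trans hcount) hp.out.pos
  exact exists_sha_ne_zero_of_level_zero_of_prime_le_strict_of_cmRamified W hCM hram h5 hpv Φ hcard P hgen hlev hle

/-! ## §3 EVEN-IRREGULAR ∧ LEVEL 0 ⟹ `Ш(W/ℚ)[p] ≠ 0` (reflection-pair currency) -/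

/-- **EVEN-IRREGULAR ∧ LEVEL `0` ⟹ `Ш(W/ℚ)[p] ≠ 0` ON THE CM-RAMIFIED RANK-ONE CLASS, granted the local Euler characteristic.**
Class member `W/ℚ` (globally minimal, CM, `CMRamified W p`, `p ≥ 5`), `v ∋ p`; `P` with `W(ℚ) = ℤ•P + torsion` of LEVEL `0` at `p`
(`p • Q ≠ P` in `W(ℚ_p)`); `Φ ≤ W[p]` a stable line of order `p` with character `θ : Γ_ℚ →* 𝔽_pˣ`; `K` a CM field, Galois over `ℚ`, `p ∤ [K:ℚ]`,
`θ(res Γ_K) = 1`, `ζ ∈ K` a primitive `p`-th root of unity (`σ ζ = ζ^{a σ}`); `χ̄` the descent of `θ`, ODD; `ψ̄ = ā χ̄⁻¹ ≠ 1` (the EVEN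
reflection `ω̄θ⁻¹`); EVEN-IRREGULARITY `#e_{ω∘ψ̄}(ℤ_p ⊗ Cl(𝓞 K)) ≠ 1`; ASSUME `localEulerPoincareCharacteristic ℚ_v`. THEN
`∃ c ∈ Ш(W/ℚ), c ≠ 0 ∧ p • c = 0`. Chain: w7 g4's `KummerRadical.exists_two_independent_kummer_characters_of_odd_character` ⟹ this seat's
`sq_le_natCard_h1Unramified_of_two_characters` (`#R_rel(Φ) ≥ p²`) ⟹ §2. So on EVEN-IRREGULAR members the registry's pair covers
everything: LEVEL `≥ 1` (B1-level) or `Ш[p] ≠ 0` (B1-sha). [cite: Washington1997, §10.2 (Thm. 10.9)] [cite: MilneADT2006, Ch. I §2 Thm. 2.8]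
[cite: SilvermanAEC2009, Thm. X.4.2] -/
theorem exists_sha_ne_zero_of_level_zero_of_classGroupChiCard_ne_one_of_cmRamified
    (hCM : W.HasCM) (hram : CMRamified W p) (h5 : 5 ≤ p)
    {v : HeightOneSpectrum (𝓞 ℚ)} (hpv : ((p : ℕ) : 𝓞 ℚ) ∈ v.asIdeal)
    (hEP : localEulerPoincareCharacteristic (v.adicCompletion ℚ))
    (Φ : StableSubgroup (absoluteGaloisGroup ℚ) (geomTorsion W (p : ℤ))) (hcard : Nat.card Φ.Sub = p)
    (P : W.toAffine.Point)
    (hgen : ∀ R : W.toAffine.Point, ∃ (k : ℤ) (T : W.toAffine.Point), IsOfFinAddOrder T ∧ R = k • P + T)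
    (hlev : ∀ Q : (W.baseChange ℚ_[p]).toAffine.Point, p • Q ≠ W.toPadicPoint p P)
    (θ : absoluteGaloisGroup ℚ →* (ZMod p)ˣ)
    (hθ : ∀ (g : absoluteGaloisGroup ℚ) (s : Φ.Sub), g • s = (((θ g : ZMod p).val : ℕ) : ℤ) • s)
    {K : Type} [Field K] [NumberField K] [IsCMField K] [IsGalois ℚ K] (hpK : ¬ p ∣ Module.finrank ℚ K)
    (hrK : ∀ σ : absoluteGaloisGroup K, θ (absGaloisRestrict ℚ K σ) = 1)
    {ζ : K} (hζ : IsPrimitiveRoot ζ p) (a : (K ≃ₐ[ℚ] K) → ℕ) (ha : ∀ σ₀ : K ≃ₐ[ℚ] K, σ₀ ζ = ζ ^ a σ₀)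
    (χb : (K ≃ₐ[ℚ] K) →* (ZMod p)ˣ) (hχb : ∀ γ : absoluteGaloisGroup ℚ, χb (absGaloisQuot ℚ K γ) = θ γ)
    (hoddχ : χb ((IsCMField.complexConj K).restrictScalars ℚ) = -1)
    (ψb : (K ≃ₐ[ℚ] K) →* (ZMod p)ˣ) (hψb1 : ψb ≠ 1)
    (hψb : ∀ σ : K ≃ₐ[ℚ] K, ((ψb σ : (ZMod p)ˣ) : ZMod p) = (a σ : ZMod p) * (((χb σ)⁻¹ : (ZMod p)ˣ) : ZMod p))
    (hne : classGroupChiCard ℚ K p (fun g => ((((Kato2004.teichmullerChar p).comp ψb) g : ℤ_[p]ˣ) : ℤ_[p])) ≠ 1) :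
    ∃ c ∈ W.sha, c ≠ 0 ∧ p • c = 0 := by
  have hp0 : ((p : ℕ) : ℤ) ≠ 0 := by exact_mod_cast hp.out.ne_zero
  have hSpfin : {v' : HeightOneSpectrum (𝓞 ℚ) | ((p : ℕ) : 𝓞 ℚ) ∈ v'.asIdeal}.Finite := by
    convert finite_setOf_intCast_mem_asIdeal (K := ℚ) hp0 using 1
    ext v'
    simp only [Set.mem_setOf_eq, Int.cast_natCast]
  have hcont : ∀ s : Φ.Sub, Continuous fun g : absoluteGaloisGroup ℚ ↦ g • s :=
    Φ.continuous_smul_sub (LevelDictionary.continuous_smul_geomTorsion W (p : ℤ))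
  obtain ⟨κ₁, κ₂, ⟨ho₁, hu₁, he₁⟩, ⟨ho₂, hu₂, he₂⟩, hind⟩ :=
    KummerRadical.exists_two_independent_kummer_characters_of_odd_character hpK hζ a ha χb hoddχ ψb hψb1 hψb hne
  have hsq := sq_le_natCard_h1Unramified_of_two_characters hcard hcont θ hθ hpK hrK hSpfin κ₁ κ₂ ho₁ ho₂
    (fun u hu => hu₁ u (natCast_not_mem_of_under_not_mem hu)) (fun u hu => hu₂ u (natCast_not_mem_of_under_not_mem hu))
    (fun γ σ => by rw [he₁ γ σ, hχb]) (fun γ σ => by rw [he₂ γ σ, hχb]) hind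
  exact exists_sha_ne_zero_of_level_zero_of_sq_le_of_cmRamified W hCM hram h5 hpv hEP Φ hcard P hgen hlev hsq

end Class

end Summit.BirchSwinnertonDyer.BirchSwinnertonDyer.Theorems.PrintCFram.SelmerCount

end
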